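import Literature.Analysis.FluidPDE.AxisymHouLiVariables
import Literature.Analysis.FluidPDE.AxisymmetricVorticityTransport
import HarnessLib

/-!
# Wei 2016, §1: `J = ω_r/r = −∂_z(u_θ/r)` in the smooth Hou–Li variables

Analysis/FluidPDE proof file (theorems only; no definitions, no named facts) on the way to
`Literature.Analysis.FluidPDE.Wei2016_logModulus_regularity`
(`LeiZhang2017AxisymmetricCriteria.lean`), after

* D. Wei, *Regularity criterion to the axially symmetric Navier–Stokes equations*, J. Math.
  Anal. Appl. 435 (2016) 402–413 = arXiv:1508.03318, §1: "`ω_r = −∂_z(u_θ)`, … Denote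
  `Ω = ω_θ/r`, `J = ω_r/r = −∂_z u_θ/r`".

In the tree the two smooth quotients are `radVelQuot (curl u) = ω_r/r` (the radial momentum
quotient of the vorticity, the `J` of the `Ω`-equation `IsClassicalNSSolutionOn.angVortQuot_eq`)
and `angVelQuot u = u_θ/r`. This file proves that they are related as printed, as an identity of
smooth functions on all of `ℝ³` (axis included):

* `Wei2016.fderiv_swirl_apply_single_two` — `∂_z Γ = x₀ ∂_z u₁ − x₁ ∂_z u₀`;
* `Wei2016.horizontal_inner_curl_eq` — `x₀ω₀ + x₁ω₁ = Du₂[Jx] − ∂_zΓ = −∂_zΓ` for an axisymmetric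
  `u` (`u₂` is an axisymmetric scalar, so its tangential derivative vanishes);
* `Wei2016.radVelQuot_curl_eq` — **`ω_r/r = −∂_z(u_θ/r)`**:
  `radVelQuot (curl u) x = −D(angVelQuot u)(x)[e_z]` for an axisymmetric `u ∈ C⁴` and every `x`
  (off the plane `{x₀ = 0}` from `r² · (ω_r/r) = x₀ω₀ + x₁ω₁ = −∂_zΓ = −r² ∂_z(u_θ/r)`, then
  everywhere by continuity, `eq_of_eq_off_ker`).

## References

* D. Wei, arXiv:1508.03318, §1 (the definitions of `Ω`, `J`). [Wei2016]
* Z. Lei, Q. S. Zhang, arXiv:1505.02628, §1: "`J = −∂_z v^θ/r = ωʳ/r`". [LeiZhang2017]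
-/

noncomputable section

open MeasureTheory Set Function Filter Topology

namespace Literature.Analysis.FluidPDE

namespace Wei2016

variable {u : EuclideanSpace ℝ (Fin 3) → EuclideanSpace ℝ (Fin 3)}

/-- `∂_b Γ = x₀ (Du b)₁ − x₁ (Du b)₀` for directions `b` with `b₀ = b₁ = 0` (`Γ = x₀u₁ − x₁u₀`).
[folklore] -/
theorem fderiv_swirl_apply_of_horizontal_zero {x : EuclideanSpace ℝ (Fin 3)}
    (hd : DifferentiableAt ℝ u x) {b : EuclideanSpace ℝ (Fin 3)} (hb0 : b 0 = 0) (hb1 : b 1 = 0) :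
    fderiv ℝ (swirl u) x b = x 0 * fderiv ℝ u x b 1 - x 1 * fderiv ℝ u x b 0 := by
  have hb : rotGen b = 0 := by
    ext i
    fin_cases i <;> simp [rotGen, hb0, hb1]
  rw [fderiv_swirl_apply hd, hb, inner_zero_left, add_zero, inner_rotGen_left]

/-- **`x₀ω₀ + x₁ω₁ = −∂_zΓ`** for an axisymmetric differentiable `u` (`ω = curl u`,
`Γ = swirl u`): `x₀ω₀ + x₁ω₁ = (x₀∂₁u₂ − x₁∂₀u₂) − (x₀∂_zu₁ − x₁∂_zu₀) = Du₂[Jx] − ∂_zΓ` and the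
tangential derivative of the axial component vanishes, `(Du[Jx])₂ = (J u)₂ = 0`. [folklore] -/
theorem horizontal_inner_curl_eq (hax : IsAxisymmetric u) {x : EuclideanSpace ℝ (Fin 3)}
    (hd : DifferentiableAt ℝ u x) :
    x 0 * FluidPDE.curl u x 0 + x 1 * FluidPDE.curl u x 1 =
      -fderiv ℝ (swirl u) x (EuclideanSpace.single 2 1) := by
  have htan := hax.fderiv_rotGen hd
  have h2 : fderiv ℝ u x (rotGen x) 2 = 0 := by rw [htan, rotGen_apply_two]
  rw [rotGen_eq_sub_single, map_sub, map_smul, map_smul] at h2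
  simp only [PiLp.sub_apply, PiLp.smul_apply, smul_eq_mul] at h2
  rw [fderiv_swirl_apply_of_horizontal_zero hd (by simp) (by simp)]
  simp only [FluidPDE.curl]
  simp
  linear_combination h2

/-- **Wei 2016 / Lei–Zhang 2017: `J = ω_r/r = −∂_z(u_θ/r)`**, as an identity of smooth functions
on `ℝ³`: for an axisymmetric `u ∈ C⁴` and every `x`,
`radVelQuot (curl u) x = −D(angVelQuot u)(x)[e_z]`. Off the plane `{x₀ = 0}`:
`r² · radVelQuot (curl u) = x₀ω₀ + x₁ω₁ = −∂_zΓ` (`horizontal_inner_curl_eq`) and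
`∂_zΓ = ∂_z(r² Φ) = r² ∂_zΦ` (`Γ = r²Φ`, `Φ = angVelQuot u`, `∂_z r² = 0`); both sides are
continuous, so the identity extends across the plane (`eq_of_eq_off_ker`).
[cite: Wei2016, §1 (definition of J)] -/
theorem radVelQuot_curl_eq (hax : IsAxisymmetric u) (hu : ContDiff ℝ 4 u)
    (x : EuclideanSpace ℝ (Fin 3)) :
    radVelQuot (FluidPDE.curl u) x = -fderiv ℝ (angVelQuot u) x (EuclideanSpace.single 2 1) := by
  have hu1 : ContDiff ℝ 1 u := hu.of_le (by norm_num)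
  have hu2 : ContDiff ℝ 2 u := hu.of_le (by norm_num)
  have hd : Differentiable ℝ u := hu1.differentiable one_ne_zero
  have hω3 : ContDiff ℝ 3 (FluidPDE.curl u) := contDiff_curl (n := 3) (by exact_mod_cast hu)
  have hω2 : ContDiff ℝ 2 (FluidPDE.curl u) := hω3.of_le (by norm_num)
  have hωax : IsAxisymmetric (FluidPDE.curl u) := hax.curl hd
  have hu3 : ContDiff ℝ 3 u := hu.of_le (by norm_num)
  have hΦ1 : ContDiff ℝ 1 (angVelQuot u) := contDiff_angVelQuot (n := 1) (by exact_mod_cast hu3)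
  -- continuity of both sides
  have hc1 : Continuous (radVelQuot (FluidPDE.curl u)) :=
    (contDiff_radVelQuot (n := 1) (by exact_mod_cast hω3)).continuous
  have hc2 : Continuous fun y => -fderiv ℝ (angVelQuot u) y (EuclideanSpace.single 2 1) :=
    ((hΦ1.continuous_fderiv one_ne_zero).clm_apply continuous_const).neg
  refine eq_of_eq_off_ker (EuclideanSpace.proj (0 : Fin 3))
    ⟨EuclideanSpace.single 0 1, by simp⟩ hc1 hc2 (fun z hz => ?_) x
  have hz0 : z 0 ≠ 0 := by simpa using hz
  have hr : cylRadius z ≠ 0 := by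
    intro h
    have h' : z 0 ^ 2 + z 1 ^ 2 = 0 := by rw [← cylRadius_sq, h]; ring
    exact hz0 (by nlinarith [sq_nonneg (z 0), sq_nonneg (z 1)])
  -- `r² · (ω_r/r) = x₀ω₀ + x₁ω₁ = −∂_zΓ`
  have hA := hωax.cylRadius_sq_mul_radVelQuot hω2 z
  rw [horizontal_inner_curl_eq hax (hd z)] at hA
  -- `∂_zΓ = r² ∂_zΦ`
  have hΓ : swirl u = fun y => cylRadius y ^ 2 * angVelQuot u y :=
    funext fun y => (hax.cylRadius_sq_mul_angVelQuot hu2 y).symm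
  have hr2 : HasFDerivAt (fun y : EuclideanSpace ℝ (Fin 3) => cylRadius y ^ 2)
      ((2 * z 0) • (EuclideanSpace.proj (0 : Fin 3) : EuclideanSpace ℝ (Fin 3) →L[ℝ] ℝ) +
        (2 * z 1) • (EuclideanSpace.proj (1 : Fin 3) : EuclideanSpace ℝ (Fin 3) →L[ℝ] ℝ)) z := by
    have h0 := (EuclideanSpace.proj (𝕜 := ℝ) (0 : Fin 3)).hasFDerivAt (x := z)
    have h1 := (EuclideanSpace.proj (𝕜 := ℝ) (1 : Fin 3)).hasFDerivAt (x := z)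
    have h := (h0.pow 2).add (h1.pow 2)
    have he : (fun y : EuclideanSpace ℝ (Fin 3) => cylRadius y ^ 2) =
        fun y => (EuclideanSpace.proj (𝕜 := ℝ) (0 : Fin 3)) y ^ 2 +
          (EuclideanSpace.proj (𝕜 := ℝ) (1 : Fin 3)) y ^ 2 := by
      funext y
      rw [cylRadius_sq]
      rfl
    rw [he]
    refine h.congr_fderiv ?_
    ext v
    simp only [_root_.add_apply, _root_.smul_apply, smul_eq_mul, PiLp.proj_apply]
    ring
  have hdΓ : fderiv ℝ (swirl u) z (EuclideanSpace.single 2 1) =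
      cylRadius z ^ 2 * fderiv ℝ (angVelQuot u) z (EuclideanSpace.single 2 1) := by
    rw [hΓ, fderiv_fun_mul hr2.differentiableAt ((hΦ1.differentiable one_ne_zero) z), hr2.fderiv]
    simp
  rw [hdΓ] at hA
  -- cancel `r² ≠ 0`
  have h := mul_left_cancel₀ (pow_ne_zero 2 hr)
    (hA.trans (by ring : -(cylRadius z ^ 2 * fderiv ℝ (angVelQuot u) z (EuclideanSpace.single 2 1)) =
      cylRadius z ^ 2 * -fderiv ℝ (angVelQuot u) z (EuclideanSpace.single 2 1)))
  exact h

end Wei2016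

end Literature.Analysis.FluidPDE

end
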